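import Literature.Topology.FourManifolds.SpikedLoopLocal
import Literature.Topology.FourManifolds.CurveFamilyIsotopy
import Literature.Topology.FourManifolds.SchubertNormalForm
import HarnessLib

/-!
# Small perturbations of simple regular loops in the chart, and their knots

Topic `Literature/Topology/FourManifolds` (trunk T-4MAN). Fact seat
`provefact-Literature.Topology.FourManifolds.Knot.IsConnectedSum.isIsotopic` (Schubert's theorem),
geometric heart for rail knots, flattening tools. Two generic facts:

* `exists_perturb_thresholds`: for a `C^∞`, `1`-periodic, regular loop `m : ℝ → ℝ³`, injective
  modulo the period, there are `θ₀ > 0`, `δ₀ > 0` such that for every `C^∞`, `1`-periodic `e` with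
  `‖e'‖ ≤ θ₀ ‖m'‖` pointwise and `‖e‖ ≤ δ₀`, every loop `m + c e`, `c ∈ [0, 1]`, is regular and
  injective modulo the period (near pairs by the tangent estimate, far pairs by the positive
  minimum distance);
* `IsChartLoopN` (chart loops for the chart `ψ` from the north pole): their knots
  (`IsChartLoopN.toKnot`), and `IsChartLoopN.isIsotopic_of_perturb`: under the thresholds the knots
  of `m + e` and `m` are isotopic (straight-line family, `IsRegularLoop.isIsotopic_of_family_eq`).

Everything is proved; no named facts are introduced.

## References

* M. W. Hirsch, *Differential Topology*, Springer GTM 33 (1976), Ch. 8 §1, Thm. 1.3. [HirschDT1976]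
-/

open scoped Manifold ContDiff Topology Real
open Function Set Metric Filter

noncomputable section

namespace Literature.Topology.FourManifolds

/-- Local notation: `𝔼 n` is the model Euclidean space `EuclideanSpace ℝ (Fin n)`. -/
local notation "𝔼 " n:arg => EuclideanSpace ℝ (Fin n)

/-- Local notation: `𝕊 n` is the unit sphere in `EuclideanSpace ℝ (Fin (n + 1))`. -/
local notation "𝕊 " n:arg => (Metric.sphere (0 : EuclideanSpace ℝ (Fin (n + 1))) 1)

attribute [local instance] fact_finrank_euclideanSpace_succ

open KnotsInBall

/-! ### Elementary tools -/

/-- A `1`-periodic function at an integer shift. [folklore] -/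
theorem _root_.Function.Periodic.sub_int_eq {X : Type*} {f : ℝ → X} (hf : Periodic f 1) (t : ℝ) (k : ℤ) : f (t - k) = f t := by
  have := hf.sub_int_mul_eq k (x := t)
  rwa [mul_one] at this

/-- A `1`-periodic function at the fractional part. [folklore] -/
theorem _root_.Function.Periodic.apply_fract {X : Type*} {f : ℝ → X} (hf : Periodic f 1) (t : ℝ) : f (Int.fract t) = f t := by
  rw [Int.fract]; exact hf.sub_int_eq t ⌊t⌋

/-- **Mean value estimate on a segment** for a `C¹` function with derivative bounded on the segment.
[folklore] -/
theorem norm_sub_le_of_deriv_bound {F : Type*} [NormedAddCommGroup F] [NormedSpace ℝ F] {f : ℝ → F}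
    (hf : Differentiable ℝ f) {s h C : ℝ} (hC : ∀ r ∈ uIcc s (s + h), ‖deriv f r‖ ≤ C) :
    ‖f (s + h) - f s‖ ≤ C * |h| := by
  have := (convex_uIcc s (s + h)).norm_image_sub_le_of_norm_deriv_le (fun x _ ↦ hf x) hC left_mem_uIcc right_mem_uIcc
  simpa using this

/-! ### Perturbation thresholds -/

/-- **PERTURBATION THRESHOLDS OF A SIMPLE REGULAR LOOP.** For a `C^∞`, `1`-periodic, regular loop
`m : ℝ → ℝ³` injective modulo the period there are `θ₀ > 0` and `δ₀ > 0` such that, for every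
`C^∞`, `1`-periodic `e` with `‖e' s‖ ≤ θ₀ ‖m' s‖` and `‖e s‖ ≤ δ₀` for all `s`, every loop
`m + c e` (`c ∈ [0, 1]`) is regular and injective modulo the period. [folklore] -/
theorem exists_perturb_thresholds {m : ℝ → 𝔼 3} (hm : ContDiff ℝ ∞ m) (hper : Periodic m 1)
    (hreg : ∀ s, deriv m s ≠ 0) (hinj : ∀ s t, m s = m t → ∃ k : ℤ, t - s = k) :
    ∃ θ₀ > 0, ∃ δ₀ > 0, ∀ e : ℝ → 𝔼 3, ContDiff ℝ ∞ e → Periodic e 1 →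
      (∀ s, ‖deriv e s‖ ≤ θ₀ * ‖deriv m s‖) → (∀ s, ‖e s‖ ≤ δ₀) → ∀ c ∈ Icc (0 : ℝ) 1,
        (∀ s, deriv (fun r ↦ m r + c • e r) s ≠ 0) ∧
          (∀ s t, m s + c • e s = m t + c • e t → ∃ k : ℤ, t - s = k) := by
  have hmd : Differentiable ℝ m := hm.differentiable (by simp)
  have hcont : Continuous (deriv m) := hm.continuous_deriv (by simp)
  have hper' : Periodic (deriv m) 1 := fun x ↦ by
    have e : (fun x ↦ m (x + 1)) = m := funext hper
    have := deriv_comp_add_const m 1 x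
    rw [e] at this
    exact this.symm
  -- the minimum `μ > 0` and the maximum `M` of `‖m'‖`
  obtain ⟨sμ, -, hsμ⟩ := isCompact_Icc.exists_isMinOn (nonempty_Icc.2 zero_le_one) (hcont.norm.continuousOn (s := Icc (0 : ℝ) 1))
  obtain ⟨sM, -, hsM⟩ := isCompact_Icc.exists_isMaxOn (nonempty_Icc.2 zero_le_one) (hcont.norm.continuousOn (s := Icc (0 : ℝ) 1))
  set μ := ‖deriv m sμ‖ with hμ
  set M := ‖deriv m sM‖ with hM
  have hμpos : 0 < μ := norm_pos_iff.2 (hreg sμ)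
  have hμle : ∀ s, μ ≤ ‖deriv m s‖ := fun s ↦ by
    have := hsμ (show Int.fract s ∈ Icc (0 : ℝ) 1 from ⟨Int.fract_nonneg s, (Int.fract_lt_one s).le⟩)
    simp only [mem_setOf_eq] at this
    rwa [hper'.apply_fract] at this
  have hMge : ∀ s, ‖deriv m s‖ ≤ M := fun s ↦ by
    have := hsM (show Int.fract s ∈ Icc (0 : ℝ) 1 from ⟨Int.fract_nonneg s, (Int.fract_lt_one s).le⟩)
    simp only [mem_setOf_eq] at this
    rwa [hper'.apply_fract] at this
  have hMpos : 0 < M := hμpos.trans_le ((hμle sM))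
  -- uniform continuity of `m'` on `[-1, 2]`
  have huc := (isCompact_Icc (a := (-1 : ℝ)) (b := 2)).uniformContinuousOn_of_continuous hcont.continuousOn
  obtain ⟨η₀, hη₀, hη⟩ := Metric.uniformContinuousOn_iff.1 huc (μ / 4) (by positivity)
  set η := min η₀ (1 / 2) with hηdef
  have hηpos : 0 < η := lt_min hη₀ (by norm_num)
  have hηle : η ≤ 1 / 2 := min_le_right _ _
  have hηle' : η ≤ η₀ := min_le_left _ _
  -- the far modulus `Λ > 0`
  set C : Set (ℝ × ℝ) := Icc (0 : ℝ) 1 ×ˢ (Icc η (1 / 2) ∪ Icc (-(1 / 2)) (-η)) with hCdef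
  have hCc : IsCompact C := isCompact_Icc.prod (isCompact_Icc.union isCompact_Icc)
  have hCne : C.Nonempty := ⟨(0, 1 / 2), ⟨⟨le_rfl, zero_le_one⟩, Or.inl ⟨hηle, le_rfl⟩⟩⟩
  set f : ℝ × ℝ → ℝ := fun p ↦ ‖m (p.1 + p.2) - m p.1‖ with hfdef
  have hfc : Continuous f := ((hm.continuous.comp (continuous_fst.add continuous_snd)).sub (hm.continuous.comp continuous_fst)).norm
  have hfpos : ∀ p ∈ C, 0 < f p := by
    rintro ⟨s, h⟩ ⟨-, hh⟩
    simp only [hfdef, norm_pos_iff, sub_ne_zero]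
    intro he
    obtain ⟨k, hk⟩ := hinj s (s + h) he.symm
    have hk' : h = k := by linarith
    have h1 : |h| < 1 := by rcases hh with hh | hh <;> [rw [abs_of_pos (by linarith [hh.1])]; rw [abs_of_neg (by linarith [hh.2])]] <;> linarith [hh.1, hh.2]
    have h2 : 0 < |h| := by rcases hh with hh | hh <;> [rw [abs_of_pos (by linarith [hh.1])]; rw [abs_of_neg (by linarith [hh.2])]] <;> linarith [hh.1, hh.2]
    rw [hk'] at h1 h2
    have h3 : |(k : ℝ)| = |((|k| : ℤ) : ℝ)| := by push_cast; rw [abs_abs]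
    have h4 : (|k| : ℤ) < 1 := by exact_mod_cast (show ((|k| : ℤ) : ℝ) < 1 by push_cast; exact h1)
    have h5 : (0 : ℤ) < |k| := by exact_mod_cast (show (0 : ℝ) < ((|k| : ℤ) : ℝ) by push_cast; exact h2)
    omega
  obtain ⟨pΛ, hpΛ, hmin⟩ := hCc.exists_isMinOn hCne hfc.continuousOn
  set Λ := f pΛ with hΛ
  have hΛpos : 0 < Λ := hfpos pΛ hpΛ
  -- the thresholds
  refine ⟨min (1 / 2) (μ / (4 * M)), lt_min (by norm_num) (by positivity), Λ / 4, by positivity, ?_⟩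
  intro e he heper hed he0 c hc
  have hed' : Differentiable ℝ e := he.differentiable (by simp)
  have hθ1 : min (1 / 2) (μ / (4 * M)) ≤ 1 / 2 := min_le_left _ _
  have hθ2 : min (1 / 2) (μ / (4 * M)) ≤ μ / (4 * M) := min_le_right _ _
  -- derivative of the perturbed loop
  have hderiv : ∀ s, deriv (fun r ↦ m r + c • e r) s = deriv m s + c • deriv e s := fun s ↦ by
    have := ((hmd s).hasDerivAt.add ((hed' s).hasDerivAt.const_smul c))
    exact this.deriv
  have hsmall : ∀ s, ‖c • deriv e s‖ ≤ 1 / 2 * ‖deriv m s‖ := fun s ↦ by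
    rw [norm_smul, Real.norm_eq_abs, abs_of_nonneg hc.1]
    have h1 : ‖deriv e s‖ ≤ 1 / 2 * ‖deriv m s‖ := (hed s).trans (mul_le_mul_of_nonneg_right hθ1 (norm_nonneg _))
    nlinarith [norm_nonneg (deriv e s), hc.1, hc.2]
  refine ⟨fun s h0 ↦ ?_, fun s t hst ↦ ?_⟩
  · rw [hderiv] at h0
    have h1 : ‖deriv m s‖ = ‖c • deriv e s‖ := by rw [eq_neg_of_add_eq_zero_left h0, norm_neg]
    linarith [hsmall s, hμle s]
  · -- injectivity: reduce to `s₀ ∈ [0, 1)` and `|h| ≤ 1/2`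
    set y : ℝ → 𝔼 3 := fun r ↦ m r + c • e r with hy
    have hyper : Periodic y 1 := fun r ↦ by simp only [hy, hper r, heper r]
    set s₀ := Int.fract s with hs₀
    set k := round (t - s) with hk
    set h := t - k - s with hh
    have hhabs : |h| ≤ 1 / 2 := by rw [hh, show t - (k : ℝ) - s = t - s - round (t - s) by rw [hk]; ring]; exact abs_sub_round _
    have hmem0 : s₀ ∈ Ico (0 : ℝ) 1 := ⟨Int.fract_nonneg s, Int.fract_lt_one s⟩
    have hys : y s₀ = y s := hyper.apply_fract s
    have hyt : y (s₀ + h) = y t := by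
      rw [show s₀ + h = t - ((k + ⌊s⌋ : ℤ) : ℝ) by rw [hh, hs₀, Int.fract]; push_cast; ring]
      exact hyper.sub_int_eq t _
    have heq : y (s₀ + h) = y s₀ := by rw [hyt, hys]; exact hst.symm
    -- it suffices that `h = 0`
    suffices h0 : h = 0 by
      refine ⟨k, ?_⟩; rw [hh] at h0; linarith
    by_contra hne
    rcases lt_or_ge |h| η with hlt | hge
    · -- near pairs: tangent estimate at `s₀`
      have hE₁ : ‖m (s₀ + h) - m s₀ - h • deriv m s₀‖ ≤ μ / 4 * |h| := by
        have hg : Differentiable ℝ (fun r ↦ m r - r • deriv m s₀) := fun r ↦ (hmd r).sub ((differentiableAt_id).smul_const _)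
        have hb : ∀ r ∈ uIcc s₀ (s₀ + h), ‖deriv (fun r ↦ m r - r • deriv m s₀) r‖ ≤ μ / 4 := by
          intro r hr
          have hd : deriv (fun r ↦ m r - r • deriv m s₀) r = deriv m r - deriv m s₀ := by
            have : HasDerivAt (fun r ↦ m r - r • deriv m s₀) (deriv m r - (1 : ℝ) • deriv m s₀) r :=
              (hmd r).hasDerivAt.sub ((hasDerivAt_id r).smul_const (deriv m s₀))
            rw [this.deriv, one_smul]
          rw [hd, ← dist_eq_norm]
          have hrs : |r - s₀| ≤ |h| := by
            rcases le_or_gt 0 h with h0 | h0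
            · rw [uIcc_of_le (by linarith)] at hr; rw [abs_of_nonneg h0, abs_le]; constructor <;> linarith [hr.1, hr.2]
            · rw [uIcc_of_ge (by linarith)] at hr; rw [abs_of_neg h0, abs_le]; constructor <;> linarith [hr.1, hr.2]
          refine (hη r ⟨by linarith [hmem0.1, (abs_le.1 hrs).1, (abs_le.1 hhabs).1], by linarith [hmem0.2, (abs_le.1 hrs).2, (abs_le.1 hhabs).2]⟩
            s₀ ⟨by linarith [hmem0.1], by linarith [hmem0.2]⟩ ?_).le
          rw [dist_eq_norm, Real.norm_eq_abs]; linarith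
        have := norm_sub_le_of_deriv_bound hg hb
        have e : m (s₀ + h) - (s₀ + h) • deriv m s₀ - (m s₀ - s₀ • deriv m s₀) = m (s₀ + h) - m s₀ - h • deriv m s₀ := by
          rw [add_smul]; abel
        rw [e] at this
        exact this
      have hE₂ : ‖e (s₀ + h) - e s₀‖ ≤ μ / (4 * M) * M * |h| := by
        refine norm_sub_le_of_deriv_bound hed' fun r _ ↦ ?_
        exact (hed r).trans ((mul_le_mul_of_nonneg_right hθ2 (norm_nonneg _)).trans (mul_le_mul_of_nonneg_left (hMge r) (by positivity)))
      have hE₂' : ‖e (s₀ + h) - e s₀‖ ≤ μ / 4 * |h| := by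
        rw [show μ / (4 * M) * M = μ / 4 by field_simp] at hE₂; exact hE₂
      -- `0 = y (s₀ + h) - y s₀ = h m'(s₀) + E₁ + c E₂`
      have hsum : h • deriv m s₀ = -((m (s₀ + h) - m s₀ - h • deriv m s₀) + c • (e (s₀ + h) - e s₀)) := by
        have : y (s₀ + h) - y s₀ = 0 := sub_eq_zero.2 heq
        simp only [hy, smul_sub] at this ⊢
        rw [← sub_eq_zero]
        rw [← this]; abel
      have hn : |h| * ‖deriv m s₀‖ ≤ μ / 4 * |h| + μ / 4 * |h| := by
        rw [← Real.norm_eq_abs, ← norm_smul, hsum, norm_neg]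
        refine (norm_add_le _ _).trans (add_le_add hE₁ ?_)
        rw [norm_smul, Real.norm_eq_abs, abs_of_nonneg hc.1]
        exact (mul_le_of_le_one_left (norm_nonneg _) hc.2).trans hE₂'
      have hh0 : 0 < |h| := abs_pos.2 hne
      have h5 : |h| * μ ≤ |h| * ‖deriv m s₀‖ := mul_le_mul_of_nonneg_left (hμle s₀) (abs_nonneg h)
      have h6 : |h| * (μ / 2) ≤ 0 := by linarith
      have h7 : 0 < |h| * (μ / 2) := by positivity
      linarith
    · -- far pairs: the modulus `Λ`
      have hpC : (s₀, h) ∈ C := by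
        refine ⟨⟨hmem0.1, hmem0.2.le⟩, ?_⟩
        rcases le_or_gt 0 h with h0 | h0
        · left; rw [abs_of_nonneg h0] at hge hhabs; exact ⟨hge, hhabs⟩
        · right; rw [abs_of_neg h0] at hge hhabs; exact ⟨by linarith, by linarith⟩
      have h1 := hmin hpC
      simp only [mem_setOf_eq] at h1
      change Λ ≤ ‖m (s₀ + h) - m s₀‖ at h1
      have h2 : m (s₀ + h) - m s₀ = -(c • (e (s₀ + h) - e s₀)) := by
        have : y (s₀ + h) - y s₀ = 0 := sub_eq_zero.2 heq
        simp only [hy, smul_sub] at this ⊢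
        rw [← sub_eq_zero]; rw [← this]; abel
      rw [h2, norm_neg, norm_smul, Real.norm_eq_abs, abs_of_nonneg hc.1] at h1
      have h3 : ‖e (s₀ + h) - e s₀‖ ≤ Λ / 4 + Λ / 4 := (norm_sub_le _ _).trans (add_le_add (he0 _) (he0 _))
      nlinarith [norm_nonneg (e (s₀ + h) - e s₀), hc.1, hc.2]

/-! ### Chart loops for the chart from the north pole -/

/-- A **chart loop** (chart `ψ` from the north pole): a `C^∞`, `1`-periodic, regular curve in `ℝ³`,
injective modulo the period. [folklore] -/
structure IsChartLoopN (k : ℝ → 𝔼 3) : Prop where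
  contDiff : ContDiff ℝ ∞ k
  periodic : Periodic k 1
  deriv_ne_zero : ∀ t, deriv k t ≠ 0
  inj : ∀ s t, k s = k t → ∃ m : ℤ, t - s = m

namespace IsChartLoopN

variable {k : ℝ → 𝔼 3} (h : IsChartLoopN k)
include h

/-- **A chart loop read through `ψ⁻¹` is a simple regular loop on `𝕊³`.** [folklore] -/
theorem loop : IsRegularLoop (fun t ↦ ((psiN.symm (k t) : 𝕊 3) : 𝔼 4)) where
  contDiff := BandData.contDiff_coe_psiN_symm.comp h.contDiff
  periodic t := by simp [h.periodic t]
  norm_eq_one t := by simp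
  deriv_ne_zero t := BandData.deriv_coe_psiN_symm_comp_ne_zero ((h.contDiff.differentiable (by simp)) t).hasDerivAt (h.deriv_ne_zero t)

/-- Injectivity of `ψ⁻¹ ∘ k` modulo the period. [folklore] -/
theorem inj_coe (s t : ℝ) (hst : ((psiN.symm (k s) : 𝕊 3) : 𝔼 4) = ((psiN.symm (k t) : 𝕊 3) : 𝔼 4)) : ∃ m : ℤ, t - s = m :=
  h.inj s t (BandData.coe_psiN_symm_injective hst)

/-- **The knot of a chart loop.** [folklore] -/
def toKnot (h : IsChartLoopN k) : Knot := h.loop.toKnot h.inj_coe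

/-- The knot through `circlePt t` is `ψ⁻¹ (k t)`. [folklore] -/
theorem toKnot_circlePt (t : ℝ) : h.toKnot (circlePt t) = psiN.symm (k t) :=
  Subtype.ext (h.loop.coe_toKnot_circlePt _ t)

/-- **A knot which is `ψ⁻¹ ∘ k` on every `circlePt t` is the knot of the chart loop `k`.** [folklore] -/
theorem toKnot_eq_of_forall {K : Knot} (hK : ∀ t, K (circlePt t) = psiN.symm (k t)) : h.toKnot = K := by
  apply DFunLike.coe_injective
  funext x
  obtain ⟨t, rfl⟩ := exists_circlePt_eq x
  rw [h.toKnot_circlePt, hK]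

omit h in
/-- **KNOTS OF A STRAIGHT-LINE FAMILY OF CHART LOOPS ARE ISOTOPIC**: if every `m + c e`
(`c ∈ [0, 1]`) is a chart loop then the knots of `m + e` and of `m` are isotopic.
[cite: HirschDT1976, Ch. 8 §1, Thm. 1.3] -/
theorem isIsotopic_of_line_family {m e : ℝ → 𝔼 3} (hm : ContDiff ℝ ∞ m) (he : ContDiff ℝ ∞ e)
    (hfam : ∀ c ∈ Icc (0 : ℝ) 1, IsChartLoopN (fun r ↦ m r + c • e r))
    (h₁ : IsChartLoopN (fun r ↦ m r + e r)) (h₀ : IsChartLoopN m) : h₁.toKnot.IsIsotopic h₀.toKnot := by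
  -- the family `u ↦ ψ⁻¹ ∘ (m + (1 - u) e)`
  set Cf : ℝ → ℝ → 𝔼 4 := fun u r ↦ ((psiN.symm (m r + (1 - u) • e r) : 𝕊 3) : 𝔼 4) with hCf
  have hC : ContDiff ℝ ∞ (uncurry Cf) := by
    have h1 : ContDiff ℝ ∞ (fun p : ℝ × ℝ ↦ m p.2 + (1 - p.1) • e p.2) :=
      (hm.comp contDiff_snd).add ((contDiff_const.sub contDiff_fst).smul (he.comp contDiff_snd))
    exact BandData.contDiff_coe_psiN_symm.comp h1
  have hmem : ∀ u ∈ Icc (0 : ℝ) 1, (1 - u) ∈ Icc (0 : ℝ) 1 := fun u hu ↦ ⟨by linarith [hu.2], by linarith [hu.1]⟩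
  have hreg : ∀ u ∈ Icc (0 : ℝ) 1, IsRegularLoop (Cf u) := fun u hu ↦ (hfam _ (hmem u hu)).loop
  have hinj : ∀ u ∈ Icc (0 : ℝ) 1, ∀ s t, Cf u s = Cf u t → ∃ m : ℤ, t - s = m := fun u hu ↦ (hfam _ (hmem u hu)).inj_coe
  have e₀ : Cf 0 = fun r ↦ ((psiN.symm (m r + e r) : 𝕊 3) : 𝔼 4) := by funext r; simp [hCf]
  have e₁ : Cf 1 = fun r ↦ ((psiN.symm (m r) : 𝕊 3) : 𝔼 4) := by funext r; simp [hCf]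
  exact IsRegularLoop.isIsotopic_of_family_eq h₁.loop h₀.loop h₁.inj_coe h₀.inj_coe hC hreg hinj e₀ e₁

omit h in
/-- **THE KNOT OF A SMALL PERTURBATION IS ISOTOPIC TO THE KNOT**: with the thresholds of
`exists_perturb_thresholds`, for every admissible perturbation `e` the knot of `m + e` is isotopic
to the knot of `m`. [cite: HirschDT1976, Ch. 8 §1, Thm. 1.3] -/
theorem isIsotopic_of_perturb {m : ℝ → 𝔼 3} (h₀ : IsChartLoopN m) :
    ∃ θ₀ > 0, ∃ δ₀ > 0, ∀ e : ℝ → 𝔼 3, ContDiff ℝ ∞ e → Periodic e 1 →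
      (∀ s, ‖deriv e s‖ ≤ θ₀ * ‖deriv m s‖) → (∀ s, ‖e s‖ ≤ δ₀) →
        ∃ h₁ : IsChartLoopN (fun r ↦ m r + e r), h₁.toKnot.IsIsotopic h₀.toKnot := by
  obtain ⟨θ₀, hθ₀, δ₀, hδ₀, H⟩ := exists_perturb_thresholds h₀.contDiff h₀.periodic h₀.deriv_ne_zero h₀.inj
  refine ⟨θ₀, hθ₀, δ₀, hδ₀, fun e he heper hed he0 ↦ ?_⟩
  have hfam : ∀ c ∈ Icc (0 : ℝ) 1, IsChartLoopN (fun r ↦ m r + c • e r) := fun c hc ↦ by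
    obtain ⟨hreg, hinj⟩ := H e he heper hed he0 c hc
    exact ⟨h₀.contDiff.add (he.const_smul c), fun r ↦ by simp only [h₀.periodic r, heper r], hreg, hinj⟩
  have h₁ : IsChartLoopN (fun r ↦ m r + e r) := by simpa using hfam 1 ⟨zero_le_one, le_rfl⟩
  exact ⟨h₁, isIsotopic_of_line_family h₀.contDiff he hfam h₁ h₀⟩

end IsChartLoopN

end Literature.Topology.FourManifolds
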